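import Mathlib.RingTheory.MvPolynomial.Basic
import Mathlib.Algebra.MvPolynomial.Funext
import Mathlib.Analysis.Complex.Basic
import Mathlib.Analysis.Calculus.FDeriv.Add
import Mathlib.Analysis.Calculus.FDeriv.Mul
import Mathlib.Algebra.Polynomial.Eval.Degree
import HarnessLib

/-!
# The auxiliary polynomial of Schneider's method at a cusp

Algebra of the auxiliary function used in Schneider's integer-valued-function method (Pólya form)
for a germ at a cusp `Φ(w) = A(w) + g(1/w)`, `σ = 1/w`: with `Ψ(σ) = Â(σ) + σ^d g(σ)`
(`Â` = the reversed jet, `σ^d A(1/σ) = Â(σ)`), the auxiliary polynomial attached to an integer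
vector `a = (a_{ij})_{i,j<D}` is
`P_a(X, Y) = ∑_{i,j} a_{ij} X^{T - e i - d j} (Â(X) + X^d Y)^j ∈ ℂ[X, Y]`
(`T ≥ e i + d j`), so that `F̂(σ) = P_a(σ, g σ)` and, at a sample point with `σ^e ν = 1` and
`Ψ(σ) = σ^d L`, `F̂(σ) = σ^T ∑ a_{ij} νⁱ Lʲ` (`eval_cuspAux_sample`). We prove: the evaluation
formula (`eval_cuspAux`), the sample formula, the sup bound (`norm_eval_cuspAux_le`), the
reversed-jet identity (`eval_revJet`, `revJet_eq_pow_mul_eval_inv`), holomorphy of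
`z ↦ Q(z, g z)` (`differentiableOn_eval_pair`), and the NON-VANISHING `P_a ≠ 0` for `a ≠ 0`,
`e ≥ 1` (`cuspAux_ne_zero`: substituting `Y = (U - Â(X))/X^d` for `X ≠ 0` turns `P_a` into
`∑ a_{ij} X^{T-ei-dj} U^j`, whose monomials are distinct).

No definitions: the polynomial is written out in every statement, with the reversed jet an
arbitrary `Ar ∈ ℂ[X, Y]` depending on `X` alone (hypothesis `eval (x, y) Ar = Arf x`).

## References

* [folklore] Th. Schneider, *J. reine angew. Math.* 183 (1941) / Math. Ann. 121 (1949);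
  M. Waldschmidt, Pólya's theorem by Schneider's method, *Acta Math. Acad. Sci. Hungar.* 31
  (1978) 21–25; D. Masser, *Auxiliary Polynomials in Number Theory* (2016), Ch. 9.
-/

noncomputable section

open MvPolynomial Finset

namespace Literature.NumberTheory.Transcendental

variable {e d D T : ℕ}

/-- Evaluation of the auxiliary polynomial: `P_a(x, y) = ∑ a_{ij} x^{T-ei-dj} (Â(x) + x^d y)^j`.
[folklore] -/
theorem eval_cuspAux (a : Fin D × Fin D → ℤ) (Ar : MvPolynomial (Fin 2) ℂ) (Arf : ℂ → ℂ)
    (hAr : ∀ x y : ℂ, eval ![x, y] Ar = Arf x) (x y : ℂ) :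
    eval ![x, y] (∑ ij : Fin D × Fin D, C (a ij : ℂ) * X 0 ^ (T - e * ij.1 - d * ij.2) *
        (Ar + X 0 ^ d * X 1) ^ (ij.2 : ℕ)) =
      ∑ ij : Fin D × Fin D, (a ij : ℂ) * x ^ (T - e * ij.1 - d * ij.2) *
        (Arf x + x ^ d * y) ^ (ij.2 : ℕ) := by
  simp [map_sum, hAr]

/-- **Sample-point formula.** If `σ^e ν = 1`, `Â(σ) + σ^d y = σ^d L` and `T ≥ e i + d j` for all
`i, j < D`, then `P_a(σ, y) = σ^T ∑ a_{ij} νⁱ Lʲ`. (At `σ = N^{-1/e}`, `ν = N`, `L = Φ(N^{1/e})`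
this says `F̂(σ_N) = σ_N^T ∑ a_{ij} Nⁱ L_Nʲ`.) [folklore] -/
theorem eval_cuspAux_sample (a : Fin D × Fin D → ℤ) (Ar : MvPolynomial (Fin 2) ℂ) (Arf : ℂ → ℂ)
    (hAr : ∀ x y : ℂ, eval ![x, y] Ar = Arf x)
    (hT : ∀ ij : Fin D × Fin D, e * ij.1 + d * ij.2 ≤ T) {σ ν L y : ℂ} (hσν : σ ^ e * ν = 1)
    (hΨ : Arf σ + σ ^ d * y = σ ^ d * L) :
    eval ![σ, y] (∑ ij : Fin D × Fin D, C (a ij : ℂ) * X 0 ^ (T - e * ij.1 - d * ij.2) *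
        (Ar + X 0 ^ d * X 1) ^ (ij.2 : ℕ)) =
      σ ^ T * ∑ ij : Fin D × Fin D, (a ij : ℂ) * ν ^ (ij.1 : ℕ) * L ^ (ij.2 : ℕ) := by
  rw [eval_cuspAux a Ar Arf hAr, hΨ, mul_sum]
  refine sum_congr rfl fun ij _ => ?_
  have h1 : σ ^ (T - e * ij.1 - d * ij.2) * (σ ^ d) ^ (ij.2 : ℕ) = σ ^ (T - e * ij.1) := by
    rw [← pow_mul, ← pow_add]
    congr 1
    have := hT ij
    omega
  have h2 : σ ^ (T - e * ij.1) = σ ^ T * ν ^ (ij.1 : ℕ) := by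
    have h3 : σ ^ (T - e * ij.1) * (σ ^ e * ν) ^ (ij.1 : ℕ) = σ ^ T * ν ^ (ij.1 : ℕ) := by
      rw [mul_pow, ← pow_mul, ← mul_assoc, ← pow_add]
      congr 2
      have := hT ij
      omega
    rw [hσν, one_pow, mul_one] at h3
    exact h3
  calc (a ij : ℂ) * σ ^ (T - e * ij.1 - d * ij.2) * (σ ^ d * L) ^ (ij.2 : ℕ)
      = (a ij : ℂ) * (σ ^ (T - e * ij.1 - d * ij.2) * (σ ^ d) ^ (ij.2 : ℕ)) * L ^ (ij.2 : ℕ) := by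
        rw [mul_pow]; ring
    _ = σ ^ T * ((a ij : ℂ) * ν ^ (ij.1 : ℕ) * L ^ (ij.2 : ℕ)) := by rw [h1, h2]; ring

/-- **Sup bound.** If `|σ| ≤ 1`, `|Â(σ) + σ^d y| ≤ C₀` with `C₀ ≥ 1` and `|a_{ij}| ≤ Λ`, then
`|P_a(σ, y)| ≤ D² Λ C₀^D`. [folklore] -/
theorem norm_eval_cuspAux_le (a : Fin D × Fin D → ℤ) (Ar : MvPolynomial (Fin 2) ℂ) (Arf : ℂ → ℂ)
    (hAr : ∀ x y : ℂ, eval ![x, y] Ar = Arf x) {σ y : ℂ} {C₀ Λ : ℝ} (hσ : ‖σ‖ ≤ 1)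
    (hC₀ : 1 ≤ C₀) (hΨ : ‖Arf σ + σ ^ d * y‖ ≤ C₀) (hΛ : 0 ≤ Λ) (ha : ∀ ij, |(a ij : ℝ)| ≤ Λ) :
    ‖eval ![σ, y] (∑ ij : Fin D × Fin D, C (a ij : ℂ) * X 0 ^ (T - e * ij.1 - d * ij.2) *
        (Ar + X 0 ^ d * X 1) ^ (ij.2 : ℕ))‖ ≤ (D : ℝ) ^ 2 * Λ * C₀ ^ D := by
  rw [eval_cuspAux a Ar Arf hAr]
  have hC₀0 : 0 ≤ C₀ := zero_le_one.trans hC₀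
  calc ‖∑ ij : Fin D × Fin D, (a ij : ℂ) * σ ^ (T - e * ij.1 - d * ij.2) *
          (Arf σ + σ ^ d * y) ^ (ij.2 : ℕ)‖
      ≤ ∑ _ij : Fin D × Fin D, Λ * C₀ ^ D := norm_sum_le_of_le _ fun ij _ => ?_
    _ = (D : ℝ) ^ 2 * Λ * C₀ ^ D := by
        rw [sum_const, card_univ, Fintype.card_prod, Fintype.card_fin, nsmul_eq_mul]
        push_cast
        ring
  rw [norm_mul, norm_mul, norm_pow, norm_pow, Complex.norm_intCast]
  have h2 : ‖σ‖ ^ (T - e * ij.1 - d * ij.2) ≤ 1 := pow_le_one₀ (norm_nonneg _) hσ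
  have h3 : ‖Arf σ + σ ^ d * y‖ ^ (ij.2 : ℕ) ≤ C₀ ^ D :=
    (pow_le_pow_left₀ (norm_nonneg _) hΨ _).trans (pow_le_pow_right₀ hC₀ ij.2.is_lt.le)
  calc |(a ij : ℝ)| * ‖σ‖ ^ (T - e * ij.1 - d * ij.2) * ‖Arf σ + σ ^ d * y‖ ^ (ij.2 : ℕ)
      ≤ Λ * 1 * C₀ ^ D :=
        mul_le_mul (mul_le_mul (ha ij) h2 (by positivity) hΛ) h3 (by positivity) (by positivity)
    _ = Λ * C₀ ^ D := by ring

/-- Evaluation of the **reversed jet** `Â = ∑_{l ≤ d} A_l X^{d-l}` (written in `ℂ[X, Y]`,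
independent of `Y`). [folklore] -/
theorem eval_revJet (A : Polynomial ℂ) (d : ℕ) (x y : ℂ) :
    eval ![x, y] (∑ l ∈ range (d + 1), C (A.coeff l) * X (0 : Fin 2) ^ (d - l)) =
      ∑ l ∈ range (d + 1), A.coeff l * x ^ (d - l) := by
  simp [map_sum]

/-- The reversed jet is `σ^d A(1/σ)`: for `σ ≠ 0` and `deg A ≤ d`,
`∑_{l ≤ d} A_l σ^{d-l} = σ^d A(σ⁻¹)`. [folklore] -/
theorem revJet_eq_pow_mul_eval_inv (A : Polynomial ℂ) {d : ℕ} (hd : A.natDegree ≤ d) {σ : ℂ}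
    (hσ : σ ≠ 0) : ∑ l ∈ range (d + 1), A.coeff l * σ ^ (d - l) = σ ^ d * A.eval σ⁻¹ := by
  rw [Polynomial.eval_eq_sum_range' (Nat.lt_succ_of_le hd), mul_sum]
  refine sum_congr rfl fun l hl => ?_
  have hl' : l ≤ d := Nat.lt_succ_iff.mp (mem_range.mp hl)
  have : σ ^ d = σ ^ (d - l) * σ ^ l := by rw [← pow_add, Nat.sub_add_cancel hl']
  rw [this, inv_pow]
  field_simp

/-- **Holomorphy of `z ↦ Q(z, g z)`** on a set where `g` is holomorphic, for any `Q ∈ ℂ[X, Y]`.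
[folklore] -/
theorem differentiableOn_eval_pair {U : Set ℂ} {g : ℂ → ℂ} (hg : DifferentiableOn ℂ g U)
    (Q : MvPolynomial (Fin 2) ℂ) :
    DifferentiableOn ℂ (fun z => eval ![z, g z] Q) U := by
  induction Q using MvPolynomial.induction_on with
  | C c => simp
  | add p q hp hq => simpa using DifferentiableOn.fun_add hp hq
  | mul_X p i hp =>
    fin_cases i
    · simpa using DifferentiableOn.fun_mul hp differentiableOn_id
    · simpa using DifferentiableOn.fun_mul hp hg

/-- **Non-vanishing of the auxiliary polynomial.** If `e ≥ 1`, `T ≥ e i + d j` for all `i, j < D`,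
`a ≠ 0`, and `Â ∈ ℂ[X, Y]` depends on `X` alone, then
`P_a = ∑ a_{ij} X^{T-ei-dj} (Â + X^d Y)^j ≠ 0`: for `x ≠ 0` the substitution
`y = (u - Â(x))/x^d` gives `P_a(x, y) = P₁(x, u)` with `P₁ = ∑ a_{ij} X^{T-ei-dj} U^j`, whose
monomials are pairwise distinct, so `P_a = 0` would force `X · P₁ = 0` as a function, hence as a
polynomial (`MvPolynomial.funext`), hence `a = 0`. [folklore] -/
theorem cuspAux_ne_zero (he : 0 < e) (hT : ∀ ij : Fin D × Fin D, e * ij.1 + d * ij.2 ≤ T)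
    {a : Fin D × Fin D → ℤ} (ha : a ≠ 0) (Ar : MvPolynomial (Fin 2) ℂ) (Arf : ℂ → ℂ)
    (hAr : ∀ x y : ℂ, eval ![x, y] Ar = Arf x) :
    (∑ ij : Fin D × Fin D, C (a ij : ℂ) * X 0 ^ (T - e * ij.1 - d * ij.2) *
        (Ar + X 0 ^ d * X 1) ^ (ij.2 : ℕ)) ≠ 0 := by
  classical
  intro hP
  -- the exponent map is injective
  have hinj : ∀ ij ij' : Fin D × Fin D,
      T - e * ij.1 - d * ij.2 = T - e * ij'.1 - d * ij'.2 → ij.2 = ij'.2 → ij = ij' := by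
    rintro ⟨i, j⟩ ⟨i', j'⟩ h0 hj
    simp only at h0 hj
    subst hj
    have h1 := hT ⟨i, j⟩
    have h2 := hT ⟨i', j⟩
    simp only at h1 h2
    have hee : e * (i : ℕ) = e * (i' : ℕ) := by
      generalize e * (i : ℕ) = p at h0 h1
      generalize e * (i' : ℕ) = p' at h0 h2
      generalize d * (j : ℕ) = r at h0 h1 h2
      omega
    have hi : (i : ℕ) = i' := Nat.eq_of_mul_eq_mul_left he hee
    rw [Prod.mk.injEq]
    exact ⟨Fin.ext hi, rfl⟩
  -- the comparison polynomial
  set P₁ : MvPolynomial (Fin 2) ℂ := ∑ ij : Fin D × Fin D,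
    C (a ij : ℂ) * X 0 ^ (T - e * ij.1 - d * ij.2) * X 1 ^ (ij.2 : ℕ) with hP₁
  obtain ⟨ij₀, hij₀⟩ : ∃ ij, a ij ≠ 0 := by
    by_contra h
    push Not at h
    exact ha (funext h)
  have hP₁ne : P₁ ≠ 0 := by
    intro h0
    have hc := congr_arg
      (coeff (Finsupp.single 0 (T - e * ij₀.1 - d * ij₀.2) + Finsupp.single 1 (ij₀.2 : ℕ))) h0
    rw [coeff_zero, hP₁, coeff_sum, sum_eq_single ij₀] at hc
    · rw [X_pow_eq_monomial, X_pow_eq_monomial, C_mul_monomial, monomial_mul, coeff_monomial,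
        if_pos (by simp)] at hc
      exact hij₀ (by exact_mod_cast (show (a ij₀ : ℂ) = 0 by simpa using hc))
    · intro ij _ hne
      rw [X_pow_eq_monomial, X_pow_eq_monomial, C_mul_monomial, monomial_mul, coeff_monomial,
        if_neg]
      intro heq
      apply hne
      have h0' := DFunLike.congr_fun heq 0
      have h1' := DFunLike.congr_fun heq 1
      simp at h0' h1'
      exact hinj ij ij₀ h0' (Fin.ext h1')
    · simp
  -- `P = 0` forces `X₀ P₁ = 0` as a function
  have hfun : ∀ x u : ℂ, eval ![x, u] (X 0 * P₁) = 0 := by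
    intro x u
    rw [map_mul, eval_X]
    by_cases hx : x = 0
    · simp [hx]
    have hxd : x ^ d ≠ 0 := pow_ne_zero _ hx
    have hev := congr_arg (eval ![x, (u - Arf x) / x ^ d]) hP
    rw [eval_cuspAux a Ar Arf hAr, map_zero] at hev
    have hsub : Arf x + x ^ d * ((u - Arf x) / x ^ d) = u := by field_simp; ring
    rw [hsub] at hev
    have h1 : eval ![x, u] P₁ = ∑ ij : Fin D × Fin D,
        (a ij : ℂ) * x ^ (T - e * ij.1 - d * ij.2) * u ^ (ij.2 : ℕ) := by
      simp [hP₁, map_sum]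
    simp only [Matrix.cons_val_zero]
    rw [h1, hev, mul_zero]
  have hzero : X 0 * P₁ = 0 := by
    apply MvPolynomial.funext
    intro x
    have hx : x = ![x 0, x 1] := by
      funext i
      fin_cases i <;> rfl
    rw [hx, hfun, map_zero]
  rcases mul_eq_zero.mp hzero with h | h
  · exact X_ne_zero _ h
  · exact hP₁ne h

end Literature.NumberTheory.Transcendental

end
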